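import Summits.QuantumFields.YangMills.Theorems.BalabanUVNodesPortS1FEInduction
import Summits.QuantumFields.YangMills.Theorems.BalabanUVNodesK0RecordFormatNamesFluctIntRec

/-!
# BalabanUVNodes — port (S1): THE TWO HALVES OF THE FE INDUCTIVE STEP as letters over DEF-1's closed carrier `recordFluctInt` (✓p828389) — FE-1 `FEChartLawStep` (the chart law
  (2.1) ↦ (2.10) ↦ (2.12): print's second bracket of (2.12) IS `recordFluctInt(B) − recordFluctInt(0)` near `B = 0`) and FE-2 `FEClusterStep` (the localisation (1.7)+(1.18)+(1.19) of that
  difference, [I] §3–§5 + [II] Lemmas 1–3, under the inductive hypothesis) — sharing the RADIUS NAMES `feChartRadius` ∕ `feDtRadius`; glue FE-1 ∧ FE-2 ⟹ ✓`FEStepBox`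
  (porter hand `hand-27930-FE-1` g0, cell `ym-nodeO-ideate`; ▶ PT-A-1 `FE-SPLIT-PROPOSAL-v2.md` §1 re-cut INSIDE the step of ✓`…PortS1FEInduction`)

`--supports stmt-QuantumFields-27930` (helper; NO `--workitem`); count-neutral.  [I] = [Balaban1987RG1]; [II] = [Balaban1988RG2Cluster].

WHY.  ✓`…PortS1FEInduction` re-shaped `stub_FE` as print's inductive step `FEStepBox` and proved `stub_FE` from {`stub_P0C`, `stub_G3C`, `FEStepBox`} (✓`…FEInductionByName.stub_FE_of_step`).
Inside the step, print separates ([I] (2.12) p.268) the CHART LAW — the (2.1) fibre integral over `V`, in the variables `B′ = (1∕i)log(VV^{(k)−1})` linearised by `B′ = B − hD̃(B)` and scaled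
`B = g_kB′`, IS `Z^{(k)} · ∫dμ_{C^{(k)}} χ_k exp[𝐏 + {…}]` up to `𝐍_k` — from the LOCALISATION of `log ∫dμ χ_k exp[…]` ((2.13); §3–§5, [II]).  DEF-1's closed carrier
`recordFluctInt F Mc a₀ ε₂₉ ε₁ ρ k v n B` (✓`…K0RecordFormatNamesFluctIntRec` :46) is (2.13) at the record with the two radii displayed: `ε₁` (the (2.9) cut-off in the SCALED variable, (c3)) and `ρ`
(the ball of ▶ PT-A-1's `D̃ = recordDt … ρ`).  THIS FILE pins both radii BY NAME — `feChartRadius ε₂₉ g := 2·arcsin(ε₂₉∕2)∕g` (the chart ball that IS the `dist1`-ball of radius `ε₂₉`, divided by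
`g = g_k`: ✓`…PortS1Chi29Window.chiFix29AxOfRecord_eq_chiFluctPrinted`) and `feDtRadius d L := ρ₀(d, L, α⋆)` (✓`recordDt_spec_uniform`'s pinned radius at the loop-smallness currency
`α⋆ := L^{1−d}∕314`, half the admissible `157α < L^{1−d}`) — and types the two halves of the step over the SAME represented family `feFluctDiff` (print's second bracket BY NAME), so that two
seats can work them independently and the glue is kernel-trivial:
* §1 radii and the represented family: `feChartRadius`, `feLoopAlpha`, `feDtRadius`, ★ `feFluctDiff F Mc a₀ ε₂₉ k v n B := ↑(recordFluctInt … (feChartRadius ε₂₉ (v (Fin.last k))) (feDtRadius d L) k v n B − same at B = 0)`.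
* §2 ★★ FE-1 `FEChartLawStep F` — under the ⁸ antecedent AND the P0-ℂ letter `P0HolExtAtRecordGL F` (positivity of the record precision: off `PosDef` ✓`recordFluctMeasure` is its `dirac 0` junk branch and
  the identity is false — located, ✓`…FluctG` :68): there is `ε⁺ > 0` such that for every `0 < ε₂₉ ≤ ε⁺`, every LZ package with its residues, all step constants and every `k` with the inductive
  hypothesis at `j < k`: at every box history `v` and volume `n`, EVENTUALLY AT `B = 0`, `phiFE F Mc a₀ ε₂₉ k v n B = feFluctDiff F Mc a₀ ε₂₉ k v n B` — [I] (2.10)–(2.12)∕(2.14) at the record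
  ((T1) chart law: ✓ fibred chart N09∕N11 ∘ ✓ Pauli chart `…PortS1ChartJacobian*` ∘ (o1) ✓`recordDt` ∘ (o3) ∘ the χ-row ✓`…Chi29Window`; (T2) exponent algebra + Gaussian normalisation
  against ✓`phiLZ`).  OPEN (XL).
* §3 ★★ FE-2 `FEClusterStep F` — under the ⁸ antecedent: for every `ε⁺ > 0` a radius `0 < ε₂₉ ≤ ε⁺`, and for every LZ package with its residues k-UNIFORM `γ₀ E₂ κ α₀ α₁` such that for every `k`
  the inductive hypothesis at `j < k` gives, at every box history, ONE `Ψ` + wrap pieces `Ew` with `Ψ.ResidueAtW … E₂ κ (feFluctDiff F Mc a₀ ε₂₉ k v)` — [I] §3–§5 + [II] Lemmas 1–3 +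
  (2.39)–(2.41) at the record (◇ lens-1 g14 `LENS-1-NODE-v20-FE-BY-NAME.md`: by name down to the activities via `B13*`∕`B13Resummation`∕`TreeLengthTorusGeometry`; open mass = the pin's
  V′_k of the record + NODE O's kernel letters).  OPEN (XXL).
* §4 ★★★ `feStepBox_of_halves : (∀ F, P0HolExtAtRecordGL F) → (∀ F, FEChartLawStep F) → (∀ F, FEClusterStep F) → ∀ F, FEStepBox F` (FE-1's `ε⁺` feeds FE-2; ✓`representsW_congr` transports
  (f′)-W along FE-1's germ identity; the other six conjuncts do not read the functional); ★★★ `portRecordFEHalfBox_of_lzjac_GL_halves : (∀ F, PortRecordLZjacHalf F) → (∀ F, P0HolExtAtRecordGL F)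
  → (∀ F, G3CAtRecordL F) → (∀ F, FEChartLawStep F) → (∀ F, FEClusterStep F) → ∀ F, PortRecordFEHalfBox F` (= the registered stub's type; the δ-Jacobian sub-half is a theorem —
  ✓`…FEInductionByName.lzjacHalf_all`, cone side).
(Q-ord) both letters keep ⁸'s order (`Mth` first, antecedent verbatim); FE-1's `ε⁺` and FE-2's `ε₂₉ ≤ ε⁺` realise print's «ε₁ sufficiently small» once for both halves; the inductive hypothesis
is the tree-currency (germ) one of ✓`FEStepBox` — the LOCATED CAVEAT of that letter (germ vs (1.1)–(1.2) domain) applies verbatim to both halves and is not repeated.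
DEDUP: `feChartRadius`, `feChartRadius_pos`, `mul_feChartRadius_le_pi`, `feLoopAlpha`, `feDtRadius`, `feFluctDiff`, `feFluctDiff_zero`, `FEChartLawStep`, `FEClusterStep`, `feStepBox_of_halves`,
`portRecordFEHalfBox_of_lzjac_GL_halves` — 0 tree hits (`rg -ow`).

HONEST STATUS.  Radius NAMES, one represented-family NAME, TWO candidate letters (OPEN, inhabited nowhere, Bałaban-strength: FE-1 XL, FE-2 XXL) and kernel glue; NOTHING of Bałaban's
(2.10)–(2.14), §3–§5 or [II] is asserted, ported, discharged or refuted; `stub_FE` NOT closed; `stub_P0C` OPEN; ⟨27930⟩ OPEN (1∕3); NODE O 0∕1; COUNT 8∕28 · K 1∕4 UNMOVED; finite 𝕋⁴_{L^K}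
at fixed ε — NOT continuum ∕ OS ∕ Clay; **the Yang–Mills mass gap (Clay) is NOT proved by any of this.**  No `sorry`, `instance`, `notation`; standard axioms.

References: T. Bałaban, *Renormalization group approach to lattice gauge field theories. I*, Comm. Math. Phys. 109 (1987) 249–301 [Balaban1987RG1] — (2.9) p.266, (2.10)–(2.14) pp.267–268,
p.268 L27–31, Thm 3 p.264, (1.18) p.263; T. Bałaban, *… II. Cluster expansions*, Comm. Math. Phys. 116 (1988) 1–22 [Balaban1988RG2Cluster] — Lemmas 1–3 pp.9, 11, 20, (2.41) p.21.
-/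

noncomputable section

open scoped BigOperators Matrix.Norms.L2Operator Topology

namespace Summit.QuantumFields.YangMills.Theorems.BalabanUVNodesPortS1

open Summit.QuantumFields.YangMills.Theorems.K0RecordFormatNames
open Literature.MathematicalPhysics.QuantumFieldTheory.Balaban1983to89
open Literature.MathematicalPhysics.QuantumFieldTheory.Balaban1983to89.Node00
open Literature.MathematicalPhysics.QuantumFieldTheory.Balaban1983to89.T4Continuum (T4Family)
open _root_.Filter

/-! ## §1  The two radii BY NAME and the represented family (print's second bracket of (2.12) at the record) -/

/-- **THE FE CHART RADIUS `ε₁ = 2·arcsin(ε₂₉∕2)∕g`** — print's (2.9) window `|B′(b)| < ε₁` that IS the record's `dist1`-window of radius `ε₂₉` (✓`…PortS1Chi29Window.chiFix29AxOfRecord_eq_chiFluctPrinted`),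
read in DEF-1's SCALED variable `B′ = g·x` ((c3) of ✓`…K0RecordFormatNamesFluctInt`; `g = g_k = v (Fin.last k)`). [cite: Balaban1987RG1, (2.9) p.266, p.268 («B = g_kB′»)] -/
def feChartRadius (ε₂₉ g : ℝ) : ℝ := 2 * Real.arcsin (ε₂₉ / 2) / g

/-- `0 < feChartRadius ε₂₉ g` for `0 < ε₂₉`, `0 < g`. [cite: Balaban1987RG1, (2.9) p.266 (bookkeeping)] -/
theorem feChartRadius_pos {ε₂₉ g : ℝ} (hε : 0 < ε₂₉) (hg : 0 < g) : 0 < feChartRadius ε₂₉ g := by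
  unfold feChartRadius
  have : 0 < Real.arcsin (ε₂₉ / 2) := Real.arcsin_pos.mpr (by linarith)
  positivity

/-- `g · feChartRadius ε₂₉ g ≤ π`: the scaled window lies inside the injectivity window of the chart (the hypothesis `hwin` of ✓`chiFix29AxOfRecord_eq_chiFluctPrinted` on its support).
[cite: Balaban1987RG1, (2.9) p.266 (bookkeeping)] -/
theorem mul_feChartRadius_le_pi (ε₂₉ : ℝ) {g : ℝ} (hg : 0 < g) : g * feChartRadius ε₂₉ g ≤ Real.pi := by
  unfold feChartRadius
  rw [mul_div_cancel₀ _ hg.ne']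
  have := Real.arcsin_le_pi_div_two (ε₂₉ / 2)
  linarith

/-- **The loop-smallness currency at which the `D̃`-radius is pinned**: `α⋆ := L^{1−d}∕314` — half of ✓`recordDt_spec_uniform`'s admissible range `157α < L^{1−d}` (at `B` near `0` the record's
centre `V^{(k)}_{ax}(W_B)` has loops near `1`, so any fixed positive currency serves the germ). [cite: Balaban1987RG1, p.267; Balaban1985Variational, (98) p.292] -/
def feLoopAlpha (d L : ℕ) : ℝ := (((L : ℝ) ^ (d - 1))⁻¹) / 314

/-- **THE FE `D̃`-RADIUS `ρ₀(d, L, α⋆)`** — ✓`recordDt_spec_uniform`'s pinned k-uniform radius `min (R∕3) (1∕(18C₂(b+1)))`, `R = 1∕(10⁸dL)`, `C₂ = 2∕R²`, `b = 6∕(L^{1−d} − 157α)`, at `α := α⋆`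
(the expression copied token for token so that the spec applies BY NAME). [cite: Balaban1987RG1, p.267 («there exists exactly one solution … an analytic function of B»)] -/
def feDtRadius (d L : ℕ) : ℝ :=
  min ((1 : ℝ) / (10 ^ 8 * d * L) / 3)
    (1 / (18 * (2 * 1 / (1 / (10 ^ 8 * (d : ℝ) * L)) ^ 2) * (6 / (((L : ℝ) ^ (d - 1))⁻¹ - 157 * feLoopAlpha d L) + 1)))

/-- ★ **`feFluctDiff` — PRINT's SECOND BRACKET OF (2.12) AT THE RECORD, BY NAME**: `B ↦ 𝐄^{(k+1)}(g_k, U_{k+1}(W_B)) − 𝐄^{(k+1)}(g_k, U_{k+1}(W_0))` = `recordFluctInt(…, B) − recordFluctInt(…, 0)` (✓p828389)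
at the pinned radii `ε₁ := feChartRadius ε₂₉ (v (Fin.last k))`, `ρ := feDtRadius d L` of the volume `recordK₀ F Mc k + n`, as a complex functional family — the object FE-1 identifies with
✓`phiFE` and FE-2 localises. [cite: Balaban1987RG1, (2.12)–(2.14) p.268] -/
def feFluctDiff (F : T4Family) (Mc : ℕ) (a₀ ε₂₉ : ℝ) (k : ℕ) (v : Fin (k + 1) → ℝ) (n : ℕ) (B : recordW F a₀ ε₂₉ k (recordK₀ F Mc k + n)) : ℂ :=
  letI θ := thetaFill F a₀ ε₂₉
  letI := θ.instVβ₁; letI := θ.instVβ₂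
  ((recordFluctInt F Mc a₀ ε₂₉ (feChartRadius ε₂₉ (v (Fin.last k)))
        (feDtRadius (F.P (recordK₀ F Mc k + n)).d (F.P (recordK₀ F Mc k + n)).L) k v n B
      - recordFluctInt F Mc a₀ ε₂₉ (feChartRadius ε₂₉ (v (Fin.last k)))
        (feDtRadius (F.P (recordK₀ F Mc k + n)).d (F.P (recordK₀ F Mc k + n)).L) k v n 0 : ℝ) : ℂ)

/-- FACE: the bracket vanishes at `B = 0` (print's normalisation «𝐍_k = the integral at U_{k+1} = 1», by subtraction). [cite: Balaban1987RG1, (2.12)∕(2.14) p.268 (bookkeeping)] -/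
theorem feFluctDiff_zero (F : T4Family) (Mc : ℕ) (a₀ ε₂₉ : ℝ) (k : ℕ) (v : Fin (k + 1) → ℝ) (n : ℕ) :
    letI θ := thetaFill F a₀ ε₂₉
    letI := θ.instVβ₁; letI := θ.instVβ₂
    feFluctDiff F Mc a₀ ε₂₉ k v n 0 = 0 := by
  simp [feFluctDiff]

/-! ## §2  ★★ FE-1: the chart law inside the step -/

/-- ★★ **FE-1 `FEChartLawStep F` — THE CHART LAW (2.1) ↦ (2.10) ↦ (2.12) AT THE RECORD, INSIDE THE INDUCTIVE STEP**: under the ⁸ antecedent and the P0-ℂ letter, for all sufficiently small (2.9)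
radii `ε₂₉`, every LZ package with its residues, all step constants and every level `k` carrying the inductive hypothesis at `j < k`: at every box history and volume, EVENTUALLY AT `B = 0`,
`phiFE = feFluctDiff` — print's statement that the second bracket of (2.12) IS (2.13)'s `log ∫dμ_{C^{(k)}} χ_k exp[𝐏 + {…}]` minus its value at `U_{k+1} = 1`.  OPEN (XL: (T1) + (T2));
inhabited nowhere; a CANDIDATE letter. [cite: Balaban1987RG1, (2.10)–(2.14) pp.267–268, (2.1)–(2.9) pp.265–266, (1.4) p.260] -/
def FEChartLawStep (F : T4Family) : Prop :=
  ∃ Mth : ℕ, ∀ Mc : ℕ, Mth ≤ Mc → ∀ (j c c₀ c₁ : ℕ) (B₃ B₃' a₀ a₁ : ℝ), Summit.QuantumFields.YangMills.Theorems.K0RecordFormatNames.McGuard F Mc → c ≤ F.L ^ j → c₀ ≤ j + 1 → c₁ ≤ j → 2 * (F.L : ℝ) ^ 2 ≤ B₃ → 0 < B₃' → 0 < a₀ → 0 < a₁ → Literature.MathematicalPhysics.QuantumFieldTheory.Balaban1983to89.Node00.VariationalThm1RegSepCoP7MGB F 2 (fun ν M g K k _s => c ≤ ν.M₁ ∧ k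 + c₀ ≤ F.m + K ∧ F.L ^ c₁ ∣ M ∧ ∀ i, 1 ≤ i → i ≤ k → Literature.MathematicalPhysics.QuantumFieldTheory.Balaban1983to89.Node00.dCubeSide (F.P K).L M (Literature.MathematicalPhysics.QuantumFieldTheory.Balaban1983to89.Node00.RkOfRecord (F.P K).L ν.r (g i)) i ∣ (F.P K).sitesPerDir 0) (Literature.MathematicalPhysics.QuantumFieldTheory.Balaban1983to89.Node00.lamDatum F) (Literature.MathematicalPhysics.QuantumFieldTheory.Balaban1983to89.Node00.dataSmall7LamTopOf F 2) B₃ a₀ a₁ → Literature.MathematicalPhysics.QuantumFieldTheory.Balaban1983to89.Node00.Gauge9RegSepTopStepGB F 2 (fun ν K Ω => Literature.MathematicalPhysics.QuantumFieldTheory.Balaban1983to89.Node00.suppDomOfRecord F ν K Ω) (F.L ^ j) (fun ν M g K k _s => c ≤ ν.M₁ ∧ k + c₀ ≤ F.m + K ∧ F.L ^ c₁ ∣ M ∧ ∀ i, 1 ≤ i → i ≤ k → Literature.MathematicalPhysics.QuantumFieldTheory.Balaban1983to89.Node00.dCubeSide (F.P K).L M (Literature.MathematicalPhysics.QuantumFieldTheory.Balaban1983to89.Node00.RkOfRecord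 (F.P K).L ν.r (g i)) i ∣ (F.P K).sitesPerDir 0) (Literature.MathematicalPhysics.QuantumFieldTheory.Balaban1983to89.Node00.lamDatum F) (Literature.MathematicalPhysics.QuantumFieldTheory.Balaban1983to89.Node00.dataSmall7LamTopOf F 2) B₃ B₃' a₀ a₁ → (∀ ε₁ : ℝ, 0 < ε₁ → ε₁ ≤ a₁ → B₃ * ε₁ ≤ a₀ → ∀ (k n : ℕ) (V : Literature.MathematicalPhysics.QuantumFieldTheory.Balaban1983to89.GaugeField (F.P (Summit.QuantumFields.YangMills.Theorems.K0RecordFormatNames.recordK₀ F Mc k + n)) (k + 1) (Literature.MathematicalPhysics.QuantumFieldTheory.Balaban1983to89.Node00.SU 2)), Literature.MathematicalPhysics.QuantumFieldTheory.Balaban1983to89.PlaqSmall ε₁ V → Literature.MathematicalPhysics.QuantumFieldTheory.Balaban1983to89.Node00.UkExists F 2 (Summit.QuantumFields.YangMills.Theorems.K0RecordFormatNames.recordK₀ F Mc k + n) (k + 1) a₀ V ∧ Literature.MathematicalPhysics.QuantumFieldTheory.Balaban1983to89.Node00.UniqueUkOrbit F 2 (Summit.QuantumFields.YangMills.Theorems.K0RecordFormatNames.recordK₀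 F Mc k + n) (k + 1) a₀ V) → (∀ (k n : ℕ) (ε₂₉ : ℝ), 0 < ε₂₉ → letI θ := Summit.QuantumFields.YangMills.Theorems.K0RecordFormatNames.thetaFill F a₀ ε₂₉; letI := θ.instVβ₁; letI := θ.instVβ₂; letI := θ.instιβ; AnalyticAt ℝ (fun B : Summit.QuantumFields.YangMills.Theorems.K0RecordFormatNames.recordW F a₀ ε₂₉ k (Summit.QuantumFields.YangMills.Theorems.K0RecordFormatNames.recordK₀ F Mc k + n) => fun (b : Literature.MathematicalPhysics.QuantumFieldTheory.Balaban1983to89.PBond (F.P (Summit.QuantumFields.YangMills.Theorems.K0RecordFormatNames.recordK₀ F Mc k + n)) 0) (i i' : Fin 2) => ((Summit.QuantumFields.YangMills.Theorems.K0RecordFormatNames.recordBgField F θ k (Summit.QuantumFields.YangMills.Theorems.K0RecordFormatNames.recordK₀ F Mc k + n) B b : Literature.MathematicalPhysics.QuantumFieldTheory.Balaban1983to89.Node00.SU 2) : Matrix (Fin 2) (Fin 2) ℂ) i i') 0) → (∃ C₉' δ₉ : ℝ, 0 ≤ C₉' ∧ 0 < δ₉ ∧ ∀ (k n : ℕ)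 (ε₂₉ : ℝ), 0 < ε₂₉ → letI θ := Summit.QuantumFields.YangMills.Theorems.K0RecordFormatNames.thetaFill F a₀ ε₂₉; letI := θ.instVβ₁; letI := θ.instVβ₂; letI := θ.instιβ; ∀ (a : θ.ιβ) (μ : Fin (F.P (Summit.QuantumFields.YangMills.Theorems.K0RecordFormatNames.recordK₀ F Mc k + n)).d) (y : Literature.MathematicalPhysics.QuantumFieldTheory.Balaban1983to89.Site (F.P (Summit.QuantumFields.YangMills.Theorems.K0RecordFormatNames.recordK₀ F Mc k + n)) (k + 1)), letI D := fderiv ℝ (fun B : Summit.QuantumFields.YangMills.Theorems.K0RecordFormatNames.recordW F a₀ ε₂₉ k (Summit.QuantumFields.YangMills.Theorems.K0RecordFormatNames.recordK₀ F Mc k + n) => fun (b : Literature.MathematicalPhysics.QuantumFieldTheory.Balaban1983to89.PBond (F.P (Summit.QuantumFields.YangMills.Theorems.K0RecordFormatNames.recordK₀ F Mc k + n)) 0) (i i' : Fin 2) => ((Summit.QuantumFields.YangMills.Theorems.K0RecordFormatNames.recordBgField F θ k (Summit.QuantumFields.YangMills.Theorems.K0RecordFormatNames.recordK₀ F Mc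 k + n) B b : Literature.MathematicalPhysics.QuantumFieldTheory.Balaban1983to89.Node00.SU 2) : Matrix (Fin 2) (Fin 2) ℂ) i i') 0 (Pi.single μ (Pi.single y (θ.bV a))); ∃ (Hr : Literature.MathematicalPhysics.QuantumFieldTheory.Balaban1983to89.PBond (F.P (Summit.QuantumFields.YangMills.Theorems.K0RecordFormatNames.recordK₀ F Mc k + n)) 0 → Fin 2 → Fin 2 → ℂ) (φ : Literature.MathematicalPhysics.QuantumFieldTheory.Balaban1983to89.Site (F.P (Summit.QuantumFields.YangMills.Theorems.K0RecordFormatNames.recordK₀ F Mc k + n)) 0 → Fin 2 → Fin 2 → ℂ), (∀ b : Literature.MathematicalPhysics.QuantumFieldTheory.Balaban1983to89.PBond (F.P (Summit.QuantumFields.YangMills.Theorems.K0RecordFormatNames.recordK₀ F Mc k + n)) 0, D b = Hr b + (φ b.src - φ (b.src.shift b.dir))) ∧ (∃ μc : Literature.MathematicalPhysics.QuantumFieldTheory.Balaban1983to89.Site (F.P (Summit.QuantumFields.YangMills.Theorems.K0RecordFormatNames.recordK₀ F Mc k + n)) (k + 1) → Fin 2 → Fin 2 → ℂ, ∀ x :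 Literature.MathematicalPhysics.QuantumFieldTheory.Balaban1983to89.Site (F.P (Summit.QuantumFields.YangMills.Theorems.K0RecordFormatNames.recordK₀ F Mc k + n)) 0, letI dv := (fun x' : Literature.MathematicalPhysics.QuantumFieldTheory.Balaban1983to89.Site (F.P (Summit.QuantumFields.YangMills.Theorems.K0RecordFormatNames.recordK₀ F Mc k + n)) 0 => ∑ ν : Fin (F.P (Summit.QuantumFields.YangMills.Theorems.K0RecordFormatNames.recordK₀ F Mc k + n)).d, (Hr ⟨x', ν⟩ - Hr ⟨x'.unshift ν, ν⟩)); ∑ ν : Fin (F.P (Summit.QuantumFields.YangMills.Theorems.K0RecordFormatNames.recordK₀ F Mc k + n)).d, (dv (x.shift ν) - (2 : ℂ) • dv x + dv (x.unshift ν)) = μc (Summit.QuantumFields.YangMills.Theorems.K0RecordFormatNames.coarsenTo (k + 1) x)) ∧ ∀ b : Literature.MathematicalPhysics.QuantumFieldTheory.Balaban1983to89.PBond (F.P (Summit.QuantumFields.YangMills.Theorems.K0RecordFormatNames.recordK₀ F Mc k + n)) 0, ‖Hr b‖ ≤ C₉' * (F.P (Summit.QuantumFields.YangMills.Theorems.K0RecordFormatNames.recordK₀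 F Mc k + n)).eta (k + 1) * Real.exp (-(δ₉ * (Literature.MathematicalPhysics.QuantumFieldTheory.Balaban1983to89.Site.tdist (Summit.QuantumFields.YangMills.Theorems.K0RecordFormatNames.coarsenTo (k + 1) b.src) y : ℝ))) ∧ (∀ ν : Fin (F.P (Summit.QuantumFields.YangMills.Theorems.K0RecordFormatNames.recordK₀ F Mc k + n)).d, ‖Hr (⟨b.src.shift ν, b.dir⟩ : Literature.MathematicalPhysics.QuantumFieldTheory.Balaban1983to89.PBond (F.P (Summit.QuantumFields.YangMills.Theorems.K0RecordFormatNames.recordK₀ F Mc k + n)) 0) - Hr b‖ ≤ C₉' * (F.P (Summit.QuantumFields.YangMills.Theorems.K0RecordFormatNames.recordK₀ F Mc k + n)).eta (k + 1) ^ 2 * Real.exp (-(δ₉ * (Literature.MathematicalPhysics.QuantumFieldTheory.Balaban1983to89.Site.tdist (Summit.QuantumFields.YangMills.Theorems.K0RecordFormatNames.coarsenTo (k + 1) b.src) y : ℝ)))) ∧ ‖∑ ν : Fin (F.P (Summit.QuantumFields.YangMills.Theorems.K0RecordFormatNames.recordK₀ F Mc k + n)).d, (Hr (⟨b.src.shift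 ν, b.dir⟩ : Literature.MathematicalPhysics.QuantumFieldTheory.Balaban1983to89.PBond (F.P (Summit.QuantumFields.YangMills.Theorems.K0RecordFormatNames.recordK₀ F Mc k + n)) 0) - (2 : ℂ) • Hr b + Hr (⟨b.src.unshift ν, b.dir⟩ : Literature.MathematicalPhysics.QuantumFieldTheory.Balaban1983to89.PBond (F.P (Summit.QuantumFields.YangMills.Theorems.K0RecordFormatNames.recordK₀ F Mc k + n)) 0))‖ ≤ C₉' * (F.P (Summit.QuantumFields.YangMills.Theorems.K0RecordFormatNames.recordK₀ F Mc k + n)).eta (k + 1) ^ 3 * Real.exp (-(δ₉ * (Literature.MathematicalPhysics.QuantumFieldTheory.Balaban1983to89.Site.tdist (Summit.QuantumFields.YangMills.Theorems.K0RecordFormatNames.coarsenTo (k + 1) b.src) y : ℝ))) ∧ ‖∑ ν : Fin (F.P (Summit.QuantumFields.YangMills.Theorems.K0RecordFormatNames.recordK₀ F Mc k + n)).d, ((Hr (⟨b.src, b.dir⟩ : Literature.MathematicalPhysics.QuantumFieldTheory.Balaban1983to89.PBond (F.P (Summit.QuantumFields.YangMills.Theorems.K0RecordFormatNames.recordK₀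 F Mc k + n)) 0) + Hr (⟨(b.src).shift b.dir, ν⟩ : Literature.MathematicalPhysics.QuantumFieldTheory.Balaban1983to89.PBond (F.P (Summit.QuantumFields.YangMills.Theorems.K0RecordFormatNames.recordK₀ F Mc k + n)) 0) - Hr (⟨(b.src).shift ν, b.dir⟩ : Literature.MathematicalPhysics.QuantumFieldTheory.Balaban1983to89.PBond (F.P (Summit.QuantumFields.YangMills.Theorems.K0RecordFormatNames.recordK₀ F Mc k + n)) 0) - Hr (⟨b.src, ν⟩ : Literature.MathematicalPhysics.QuantumFieldTheory.Balaban1983to89.PBond (F.P (Summit.QuantumFields.YangMills.Theorems.K0RecordFormatNames.recordK₀ F Mc k + n)) 0)) - (Hr (⟨b.src.unshift ν, b.dir⟩ : Literature.MathematicalPhysics.QuantumFieldTheory.Balaban1983to89.PBond (F.P (Summit.QuantumFields.YangMills.Theorems.K0RecordFormatNames.recordK₀ F Mc k + n)) 0) + Hr (⟨(b.src.unshift ν).shift b.dir, ν⟩ : Literature.MathematicalPhysics.QuantumFieldTheory.Balaban1983to89.PBond (F.P (Summit.QuantumFields.YangMills.Theorems.K0RecordFormatNames.recordK₀ F Mc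 k + n)) 0) - Hr (⟨(b.src.unshift ν).shift ν, b.dir⟩ : Literature.MathematicalPhysics.QuantumFieldTheory.Balaban1983to89.PBond (F.P (Summit.QuantumFields.YangMills.Theorems.K0RecordFormatNames.recordK₀ F Mc k + n)) 0) - Hr (⟨b.src.unshift ν, ν⟩ : Literature.MathematicalPhysics.QuantumFieldTheory.Balaban1983to89.PBond (F.P (Summit.QuantumFields.YangMills.Theorems.K0RecordFormatNames.recordK₀ F Mc k + n)) 0)))‖ ≤ C₉' * (F.P (Summit.QuantumFields.YangMills.Theorems.K0RecordFormatNames.recordK₀ F Mc k + n)).eta (k + 1) ^ 3 * Real.exp (-(δ₉ * (Literature.MathematicalPhysics.QuantumFieldTheory.Balaban1983to89.Site.tdist (Summit.QuantumFields.YangMills.Theorems.K0RecordFormatNames.coarsenTo (k + 1) b.src) y : ℝ)))) → Summit.QuantumFields.YangMills.Theorems.K0RecordFormatNames.P0HolExtAtRecordGL F → ∃ εp : ℝ, 0 < εp ∧ ∀ ε₂₉ : ℝ, 0 < ε₂₉ → ε₂₉ ≤ εp → ∀ (E₁ κ₁ β₀ β₁ : ℝ), 0 ≤ E₁ → 4 *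 Literature.MathematicalPhysics.QuantumFieldTheory.Balaban1983to89.B12TreeDecay.kappa₀ (4 * 2 ^ 4) (2 * 4) ≤ κ₁ → 0 < β₀ → 0 < β₁ → (∀ k : ℕ, Summit.QuantumFields.YangMills.Theorems.BalabanUVNodesPortS1.LZResidueAt F Mc a₀ ε₂₉ β₀ β₁ E₁ κ₁ k) → ∀ (γ₀ E₂ κ α₀ α₁ : ℝ), 0 < γ₀ → 0 ≤ E₂ → 4 * Literature.MathematicalPhysics.QuantumFieldTheory.Balaban1983to89.B12TreeDecay.kappa₀ (4 * 2 ^ 4) (2 * 4) ≤ κ → 0 < α₀ → 0 < α₁ → ∀ k : ℕ, (∀ j : ℕ, j < k → Summit.QuantumFields.YangMills.Theorems.BalabanUVNodesPortS1.FEResidueBoxAt F Mc a₀ ε₂₉ γ₀ α₀ α₁ E₂ κ j) → ∀ v : Fin (k + 1) → ℝ, v ∈ Literature.MathematicalPhysics.QuantumFieldTheory.Balaban1983to89.FlowStep.Box γ₀ k → ∀ n : ℕ, letI θ := Summit.QuantumFields.YangMills.Theorems.K0RecordFormatNames.thetaFill F a₀ ε₂₉; letI := θ.instVβ₁; letI :=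 θ.instVβ₂; letI := θ.instιβ; ∀ᶠ B in nhds (0 : Summit.QuantumFields.YangMills.Theorems.K0RecordFormatNames.recordW F a₀ ε₂₉ k (Summit.QuantumFields.YangMills.Theorems.K0RecordFormatNames.recordK₀ F Mc k + n)), Summit.QuantumFields.YangMills.Theorems.BalabanUVNodesPortS1.phiFE F Mc a₀ ε₂₉ k v n B = Summit.QuantumFields.YangMills.Theorems.BalabanUVNodesPortS1.feFluctDiff F Mc a₀ ε₂₉ k v n B

/-! ## §3  ★★ FE-2: the localisation of the fluctuation integral inside the step -/

/-- ★★ **FE-2 `FEClusterStep F` — THE LOCALISATION OF (2.13) AT THE RECORD, INSIDE THE INDUCTIVE STEP**: under the ⁸ antecedent, for every bound `ε⁺ > 0` a (2.9) radius `0 < ε₂₉ ≤ ε⁺` and, for every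
LZ package with its residues, k-UNIFORM `γ₀ E₂ κ α₀ α₁` such that for every `k` the inductive hypothesis at `j < k` yields, at every box history, ONE integer-local formula `Ψ` + wrap pieces `Ew`
with `Ψ.ResidueAtW … E₂ κ (feFluctDiff F Mc a₀ ε₂₉ k v)` — (1.7)+(1.18)+(1.19) for `𝐄^{(k+1)}(g_k, U_{k+1}(W_B)) − 𝐄^{(k+1)}(g_k, 1)`: [I] §3–§5 + [II] Lemmas 1–3 + (2.39)–(2.41).  OPEN (XXL);
inhabited nowhere; a CANDIDATE letter. [cite: Balaban1987RG1, (2.13) p.268, p.269 L30–33, (1.7) p.261, (1.18)–(1.19) p.263; Balaban1988RG2Cluster, Lemma 1 p.9, Lemma 2 p.11, Lemma 3 p.20, (2.41) p.21] -/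
def FEClusterStep (F : T4Family) : Prop :=
  ∃ Mth : ℕ, ∀ Mc : ℕ, Mth ≤ Mc → ∀ (j c c₀ c₁ : ℕ) (B₃ B₃' a₀ a₁ : ℝ), Summit.QuantumFields.YangMills.Theorems.K0RecordFormatNames.McGuard F Mc → c ≤ F.L ^ j → c₀ ≤ j + 1 → c₁ ≤ j → 2 * (F.L : ℝ) ^ 2 ≤ B₃ → 0 < B₃' → 0 < a₀ → 0 < a₁ → Literature.MathematicalPhysics.QuantumFieldTheory.Balaban1983to89.Node00.VariationalThm1RegSepCoP7MGB F 2 (fun ν M g K k _s => c ≤ ν.M₁ ∧ k + c₀ ≤ F.m + K ∧ F.L ^ c₁ ∣ M ∧ ∀ i, 1 ≤ i → i ≤ k → Literature.MathematicalPhysics.QuantumFieldTheory.Balaban1983to89.Node00.dCubeSide (F.P K).L M (Literature.MathematicalPhysics.QuantumFieldTheory.Balaban1983to89.Node00.RkOfRecord (F.P K).L ν.r (g i)) i ∣ (F.P K).sitesPerDir 0) (Literature.MathematicalPhysics.QuantumFieldTheory.Balaban1983to89.Node00.lamDatum F) (Literature.MathematicalPhysics.QuantumFieldTheory.Balaban1983to89.Node00.dataSmall7LamTopOf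 F 2) B₃ a₀ a₁ → Literature.MathematicalPhysics.QuantumFieldTheory.Balaban1983to89.Node00.Gauge9RegSepTopStepGB F 2 (fun ν K Ω => Literature.MathematicalPhysics.QuantumFieldTheory.Balaban1983to89.Node00.suppDomOfRecord F ν K Ω) (F.L ^ j) (fun ν M g K k _s => c ≤ ν.M₁ ∧ k + c₀ ≤ F.m + K ∧ F.L ^ c₁ ∣ M ∧ ∀ i, 1 ≤ i → i ≤ k → Literature.MathematicalPhysics.QuantumFieldTheory.Balaban1983to89.Node00.dCubeSide (F.P K).L M (Literature.MathematicalPhysics.QuantumFieldTheory.Balaban1983to89.Node00.RkOfRecord (F.P K).L ν.r (g i)) i ∣ (F.P K).sitesPerDir 0) (Literature.MathematicalPhysics.QuantumFieldTheory.Balaban1983to89.Node00.lamDatum F) (Literature.MathematicalPhysics.QuantumFieldTheory.Balaban1983to89.Node00.dataSmall7LamTopOf F 2) B₃ B₃' a₀ a₁ → (∀ ε₁ : ℝ, 0 < ε₁ → ε₁ ≤ a₁ → B₃ * ε₁ ≤ a₀ → ∀ (k n : ℕ) (V : Literature.MathematicalPhysics.QuantumFieldTheory.Balaban1983to89.GaugeField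 (F.P (Summit.QuantumFields.YangMills.Theorems.K0RecordFormatNames.recordK₀ F Mc k + n)) (k + 1) (Literature.MathematicalPhysics.QuantumFieldTheory.Balaban1983to89.Node00.SU 2)), Literature.MathematicalPhysics.QuantumFieldTheory.Balaban1983to89.PlaqSmall ε₁ V → Literature.MathematicalPhysics.QuantumFieldTheory.Balaban1983to89.Node00.UkExists F 2 (Summit.QuantumFields.YangMills.Theorems.K0RecordFormatNames.recordK₀ F Mc k + n) (k + 1) a₀ V ∧ Literature.MathematicalPhysics.QuantumFieldTheory.Balaban1983to89.Node00.UniqueUkOrbit F 2 (Summit.QuantumFields.YangMills.Theorems.K0RecordFormatNames.recordK₀ F Mc k + n) (k + 1) a₀ V) → (∀ (k n : ℕ) (ε₂₉ : ℝ), 0 < ε₂₉ → letI θ := Summit.QuantumFields.YangMills.Theorems.K0RecordFormatNames.thetaFill F a₀ ε₂₉; letI := θ.instVβ₁; letI := θ.instVβ₂; letI := θ.instιβ; AnalyticAt ℝ (fun B : Summit.QuantumFields.YangMills.Theorems.K0RecordFormatNames.recordW F a₀ ε₂₉ k (Summit.QuantumFields.YangMills.Theorems.K0RecordFormatNames.recordK₀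 F Mc k + n) => fun (b : Literature.MathematicalPhysics.QuantumFieldTheory.Balaban1983to89.PBond (F.P (Summit.QuantumFields.YangMills.Theorems.K0RecordFormatNames.recordK₀ F Mc k + n)) 0) (i i' : Fin 2) => ((Summit.QuantumFields.YangMills.Theorems.K0RecordFormatNames.recordBgField F θ k (Summit.QuantumFields.YangMills.Theorems.K0RecordFormatNames.recordK₀ F Mc k + n) B b : Literature.MathematicalPhysics.QuantumFieldTheory.Balaban1983to89.Node00.SU 2) : Matrix (Fin 2) (Fin 2) ℂ) i i') 0) → (∃ C₉' δ₉ : ℝ, 0 ≤ C₉' ∧ 0 < δ₉ ∧ ∀ (k n : ℕ) (ε₂₉ : ℝ), 0 < ε₂₉ → letI θ := Summit.QuantumFields.YangMills.Theorems.K0RecordFormatNames.thetaFill F a₀ ε₂₉; letI := θ.instVβ₁; letI := θ.instVβ₂; letI := θ.instιβ; ∀ (a : θ.ιβ) (μ : Fin (F.P (Summit.QuantumFields.YangMills.Theorems.K0RecordFormatNames.recordK₀ F Mc k + n)).d) (y : Literature.MathematicalPhysics.QuantumFieldTheory.Balaban1983to89.Site (F.P (Summit.QuantumFields.YangMills.Theorems.K0RecordFormatNames.recordK₀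 F Mc k + n)) (k + 1)), letI D := fderiv ℝ (fun B : Summit.QuantumFields.YangMills.Theorems.K0RecordFormatNames.recordW F a₀ ε₂₉ k (Summit.QuantumFields.YangMills.Theorems.K0RecordFormatNames.recordK₀ F Mc k + n) => fun (b : Literature.MathematicalPhysics.QuantumFieldTheory.Balaban1983to89.PBond (F.P (Summit.QuantumFields.YangMills.Theorems.K0RecordFormatNames.recordK₀ F Mc k + n)) 0) (i i' : Fin 2) => ((Summit.QuantumFields.YangMills.Theorems.K0RecordFormatNames.recordBgField F θ k (Summit.QuantumFields.YangMills.Theorems.K0RecordFormatNames.recordK₀ F Mc k + n) B b : Literature.MathematicalPhysics.QuantumFieldTheory.Balaban1983to89.Node00.SU 2) : Matrix (Fin 2) (Fin 2) ℂ) i i') 0 (Pi.single μ (Pi.single y (θ.bV a))); ∃ (Hr : Literature.MathematicalPhysics.QuantumFieldTheory.Balaban1983to89.PBond (F.P (Summit.QuantumFields.YangMills.Theorems.K0RecordFormatNames.recordK₀ F Mc k + n)) 0 → Fin 2 → Fin 2 → ℂ) (φ : Literature.MathematicalPhysics.QuantumFieldTheory.Balaban1983to89.Site (F.P (Summit.QuantumFields.YangMills.Theorems.K0RecordFormatNames.recordK₀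 F Mc k + n)) 0 → Fin 2 → Fin 2 → ℂ), (∀ b : Literature.MathematicalPhysics.QuantumFieldTheory.Balaban1983to89.PBond (F.P (Summit.QuantumFields.YangMills.Theorems.K0RecordFormatNames.recordK₀ F Mc k + n)) 0, D b = Hr b + (φ b.src - φ (b.src.shift b.dir))) ∧ (∃ μc : Literature.MathematicalPhysics.QuantumFieldTheory.Balaban1983to89.Site (F.P (Summit.QuantumFields.YangMills.Theorems.K0RecordFormatNames.recordK₀ F Mc k + n)) (k + 1) → Fin 2 → Fin 2 → ℂ, ∀ x : Literature.MathematicalPhysics.QuantumFieldTheory.Balaban1983to89.Site (F.P (Summit.QuantumFields.YangMills.Theorems.K0RecordFormatNames.recordK₀ F Mc k + n)) 0, letI dv := (fun x' : Literature.MathematicalPhysics.QuantumFieldTheory.Balaban1983to89.Site (F.P (Summit.QuantumFields.YangMills.Theorems.K0RecordFormatNames.recordK₀ F Mc k + n)) 0 => ∑ ν : Fin (F.P (Summit.QuantumFields.YangMills.Theorems.K0RecordFormatNames.recordK₀ F Mc k + n)).d, (Hr ⟨x', ν⟩ - Hr ⟨x'.unshift ν, ν⟩)); ∑ ν : Fin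 (F.P (Summit.QuantumFields.YangMills.Theorems.K0RecordFormatNames.recordK₀ F Mc k + n)).d, (dv (x.shift ν) - (2 : ℂ) • dv x + dv (x.unshift ν)) = μc (Summit.QuantumFields.YangMills.Theorems.K0RecordFormatNames.coarsenTo (k + 1) x)) ∧ ∀ b : Literature.MathematicalPhysics.QuantumFieldTheory.Balaban1983to89.PBond (F.P (Summit.QuantumFields.YangMills.Theorems.K0RecordFormatNames.recordK₀ F Mc k + n)) 0, ‖Hr b‖ ≤ C₉' * (F.P (Summit.QuantumFields.YangMills.Theorems.K0RecordFormatNames.recordK₀ F Mc k + n)).eta (k + 1) * Real.exp (-(δ₉ * (Literature.MathematicalPhysics.QuantumFieldTheory.Balaban1983to89.Site.tdist (Summit.QuantumFields.YangMills.Theorems.K0RecordFormatNames.coarsenTo (k + 1) b.src) y : ℝ))) ∧ (∀ ν : Fin (F.P (Summit.QuantumFields.YangMills.Theorems.K0RecordFormatNames.recordK₀ F Mc k + n)).d, ‖Hr (⟨b.src.shift ν, b.dir⟩ : Literature.MathematicalPhysics.QuantumFieldTheory.Balaban1983to89.PBond (F.P (Summit.QuantumFields.YangMills.Theorems.K0RecordFormatNames.recordK₀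 F Mc k + n)) 0) - Hr b‖ ≤ C₉' * (F.P (Summit.QuantumFields.YangMills.Theorems.K0RecordFormatNames.recordK₀ F Mc k + n)).eta (k + 1) ^ 2 * Real.exp (-(δ₉ * (Literature.MathematicalPhysics.QuantumFieldTheory.Balaban1983to89.Site.tdist (Summit.QuantumFields.YangMills.Theorems.K0RecordFormatNames.coarsenTo (k + 1) b.src) y : ℝ)))) ∧ ‖∑ ν : Fin (F.P (Summit.QuantumFields.YangMills.Theorems.K0RecordFormatNames.recordK₀ F Mc k + n)).d, (Hr (⟨b.src.shift ν, b.dir⟩ : Literature.MathematicalPhysics.QuantumFieldTheory.Balaban1983to89.PBond (F.P (Summit.QuantumFields.YangMills.Theorems.K0RecordFormatNames.recordK₀ F Mc k + n)) 0) - (2 : ℂ) • Hr b + Hr (⟨b.src.unshift ν, b.dir⟩ : Literature.MathematicalPhysics.QuantumFieldTheory.Balaban1983to89.PBond (F.P (Summit.QuantumFields.YangMills.Theorems.K0RecordFormatNames.recordK₀ F Mc k + n)) 0))‖ ≤ C₉' * (F.P (Summit.QuantumFields.YangMills.Theorems.K0RecordFormatNames.recordK₀ F Mc k + n)).eta (k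 + 1) ^ 3 * Real.exp (-(δ₉ * (Literature.MathematicalPhysics.QuantumFieldTheory.Balaban1983to89.Site.tdist (Summit.QuantumFields.YangMills.Theorems.K0RecordFormatNames.coarsenTo (k + 1) b.src) y : ℝ))) ∧ ‖∑ ν : Fin (F.P (Summit.QuantumFields.YangMills.Theorems.K0RecordFormatNames.recordK₀ F Mc k + n)).d, ((Hr (⟨b.src, b.dir⟩ : Literature.MathematicalPhysics.QuantumFieldTheory.Balaban1983to89.PBond (F.P (Summit.QuantumFields.YangMills.Theorems.K0RecordFormatNames.recordK₀ F Mc k + n)) 0) + Hr (⟨(b.src).shift b.dir, ν⟩ : Literature.MathematicalPhysics.QuantumFieldTheory.Balaban1983to89.PBond (F.P (Summit.QuantumFields.YangMills.Theorems.K0RecordFormatNames.recordK₀ F Mc k + n)) 0) - Hr (⟨(b.src).shift ν, b.dir⟩ : Literature.MathematicalPhysics.QuantumFieldTheory.Balaban1983to89.PBond (F.P (Summit.QuantumFields.YangMills.Theorems.K0RecordFormatNames.recordK₀ F Mc k + n)) 0) - Hr (⟨b.src, ν⟩ : Literature.MathematicalPhysics.QuantumFieldTheory.Balaban1983to89.PBond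 (F.P (Summit.QuantumFields.YangMills.Theorems.K0RecordFormatNames.recordK₀ F Mc k + n)) 0)) - (Hr (⟨b.src.unshift ν, b.dir⟩ : Literature.MathematicalPhysics.QuantumFieldTheory.Balaban1983to89.PBond (F.P (Summit.QuantumFields.YangMills.Theorems.K0RecordFormatNames.recordK₀ F Mc k + n)) 0) + Hr (⟨(b.src.unshift ν).shift b.dir, ν⟩ : Literature.MathematicalPhysics.QuantumFieldTheory.Balaban1983to89.PBond (F.P (Summit.QuantumFields.YangMills.Theorems.K0RecordFormatNames.recordK₀ F Mc k + n)) 0) - Hr (⟨(b.src.unshift ν).shift ν, b.dir⟩ : Literature.MathematicalPhysics.QuantumFieldTheory.Balaban1983to89.PBond (F.P (Summit.QuantumFields.YangMills.Theorems.K0RecordFormatNames.recordK₀ F Mc k + n)) 0) - Hr (⟨b.src.unshift ν, ν⟩ : Literature.MathematicalPhysics.QuantumFieldTheory.Balaban1983to89.PBond (F.P (Summit.QuantumFields.YangMills.Theorems.K0RecordFormatNames.recordK₀ F Mc k + n)) 0)))‖ ≤ C₉' * (F.P (Summit.QuantumFields.YangMills.Theorems.K0RecordFormatNames.recordK₀ F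 Mc k + n)).eta (k + 1) ^ 3 * Real.exp (-(δ₉ * (Literature.MathematicalPhysics.QuantumFieldTheory.Balaban1983to89.Site.tdist (Summit.QuantumFields.YangMills.Theorems.K0RecordFormatNames.coarsenTo (k + 1) b.src) y : ℝ)))) → ∀ εp : ℝ, 0 < εp → ∃ ε₂₉ : ℝ, 0 < ε₂₉ ∧ ε₂₉ ≤ εp ∧ ∀ (E₁ κ₁ β₀ β₁ : ℝ), 0 ≤ E₁ → 4 * Literature.MathematicalPhysics.QuantumFieldTheory.Balaban1983to89.B12TreeDecay.kappa₀ (4 * 2 ^ 4) (2 * 4) ≤ κ₁ → 0 < β₀ → 0 < β₁ → (∀ k : ℕ, Summit.QuantumFields.YangMills.Theorems.BalabanUVNodesPortS1.LZResidueAt F Mc a₀ ε₂₉ β₀ β₁ E₁ κ₁ k) → ∃ γ₀ E₂ κ α₀ α₁ : ℝ, 0 < γ₀ ∧ 0 ≤ E₂ ∧ 4 * Literature.MathematicalPhysics.QuantumFieldTheory.Balaban1983to89.B12TreeDecay.kappa₀ (4 * 2 ^ 4) (2 * 4) ≤ κ ∧ 0 < α₀ ∧ 0 < α₁ ∧ ∀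 k : ℕ, (∀ j : ℕ, j < k → Summit.QuantumFields.YangMills.Theorems.BalabanUVNodesPortS1.FEResidueBoxAt F Mc a₀ ε₂₉ γ₀ α₀ α₁ E₂ κ j) → ∀ v : Fin (k + 1) → ℝ, v ∈ Literature.MathematicalPhysics.QuantumFieldTheory.Balaban1983to89.FlowStep.Box γ₀ k → ∃ (Ψ : Summit.QuantumFields.YangMills.Theorems.K0RecordFormatNames.IntLocalFormula (F.L ^ (k + 1) * Mc)) (Ew : Summit.QuantumFields.YangMills.Theorems.K0RecordFormatNames.TorusPieces F Mc k), Ψ.ResidueAtW F Mc k Ew a₀ ε₂₉ α₀ α₁ E₂ κ (Summit.QuantumFields.YangMills.Theorems.BalabanUVNodesPortS1.feFluctDiff F Mc a₀ ε₂₉ k v)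

/-! ## §4  ★★★ The glue: FE-1 ∧ FE-2 ⟹ the step; `PortRecordFEHalfBox` from the letters -/

/-- ★★★ **THE INDUCTIVE STEP FROM ITS TWO HALVES**: FE-1's `ε⁺` (available under the P0-ℂ letter) feeds FE-2, which returns `ε₂₉ ≤ ε⁺` and the step constants; at `(k, v)` FE-2's `(Ψ, Ew)`
has the six functional-free rows and (f′)-W for `feFluctDiff`, transported to `phiFE` along FE-1's germ identity (✓`representsW_congr`).  CONDITIONAL bookkeeping; all three letters OPEN.
[cite: Balaban1987RG1, (2.12)–(2.14) p.268, p.268 L27–31] -/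
theorem feStepBox_of_halves (hP0C : ∀ F, P0HolExtAtRecordGL F) (h1 : ∀ F, FEChartLawStep F) (h2 : ∀ F, FEClusterStep F) : ∀ F, FEStepBox F := by
  intro F
  obtain ⟨M₁, H₁⟩ := h1 F
  obtain ⟨M₂, H₂⟩ := h2 F
  refine ⟨max M₁ M₂, fun Mc hMc j c c₀ c₁ B₃ B₃' a₀ a₁ hG h₁ h₂ h₃ h₄ h₅ h₆ h₇ hT8 hT9 hTE hP9 hP9L => ?_⟩
  obtain ⟨εp, hεp, HC⟩ := H₁ Mc (le_of_max_le_left hMc) j c c₀ c₁ B₃ B₃' a₀ a₁ hG h₁ h₂ h₃ h₄ h₅ h₆ h₇ hT8 hT9 hTE hP9 hP9L (hP0C F)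
  obtain ⟨ε₂₉, hε, hεle, HK⟩ := H₂ Mc (le_of_max_le_right hMc) j c c₀ c₁ B₃ B₃' a₀ a₁ hG h₁ h₂ h₃ h₄ h₅ h₆ h₇ hT8 hT9 hTE hP9 hP9L εp hεp
  refine ⟨ε₂₉, hε, fun E₁ κ₁ β₀ β₁ hE₁ hκ₁ hβ₀ hβ₁ hLZ => ?_⟩
  obtain ⟨γ₀, E₂, κ, α₀, α₁, hγ, hE₂, hκ, hα₀, hα₁, HS⟩ := HK E₁ κ₁ β₀ β₁ hE₁ hκ₁ hβ₀ hβ₁ hLZ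
  refine ⟨γ₀, E₂, κ, α₀, α₁, hγ, hE₂, hκ, hα₀, hα₁, fun k ih v hv => ?_⟩
  obtain ⟨Ψ, Ew, hR⟩ := HS k ih v hv
  have hgerm := HC ε₂₉ hε hεle E₁ κ₁ β₀ β₁ hE₁ hκ₁ hβ₀ hβ₁ hLZ γ₀ E₂ κ α₀ α₁ hγ hE₂ hκ hα₀ hα₁ k ih v hv
  exact ⟨Ψ, Ew, hR.1, hR.2.1, hR.2.2.1, hR.2.2.2.1, hR.2.2.2.2.1, hR.2.2.2.2.2.1,
    representsW_congr F _ _ a₀ ε₂₉ _ _ hgerm hR.2.2.2.2.2.2⟩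

/-- ★★★ **`PortRecordFEHalfBox` — THE REGISTERED STUB's TYPE — FROM THE δ-JACOBIAN SUB-HALF, THE P0-ℂ LETTER, THE G3C LETTER AND THE TWO FE HALVES** (✓`portRecordFEHalfBox_of_lzjac_GL_step` ∘
`feStepBox_of_halves`; the δ-Jacobian sub-half is a theorem of the tree, ✓`…FEInductionByName.lzjacHalf_all`, cone side).  CONDITIONAL bookkeeping; the four letters OPEN.
[cite: Balaban1987RG1, Thm 3 p.264, (2.12)–(2.14) p.268] -/
theorem portRecordFEHalfBox_of_lzjac_GL_halves (hJ : ∀ F, PortRecordLZjacHalf F) (hP0C : ∀ F, P0HolExtAtRecordGL F) (hG3C : ∀ F, G3CAtRecordL F)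
    (h1 : ∀ F, FEChartLawStep F) (h2 : ∀ F, FEClusterStep F) :
    ∀ F, Summit.QuantumFields.YangMills.Theorems.BalabanUVNodesPortS1.PortRecordFEHalfBox F :=
  portRecordFEHalfBox_of_lzjac_GL_step hJ hP0C hG3C (feStepBox_of_halves hP0C h1 h2)

-- standard axioms only
#print axioms feStepBox_of_halves
#print axioms portRecordFEHalfBox_of_lzjac_GL_halves

end Summit.QuantumFields.YangMills.Theorems.BalabanUVNodesPortS1

end
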